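import Summits.BirchSwinnertonDyer.Rank1Residual.X9.MainConjectureInstancesN3
import Summits.BirchSwinnertonDyer.Rank1Residual.X9.ChaDescentRecordsS4
import Summits.BirchSwinnertonDyer.Rank1Residual.X9.ChaDescentRecordsS4b
import Summits.BirchSwinnertonDyer.Rank1Residual.X9.ChaUnitCoeffRecordsS4
import Summits.BirchSwinnertonDyer.Rank1Residual.X9.ChaUnitCoeffRecordsS4b
import HarnessLib

/-!
# Class X9 (N3), rank `0`: Mazur's cyclotomic main conjecture INTEGRALLY WITH `μ = 0` — Greenberg's Conj. 1.11 — AT THE PAIR,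
# part e: the N3 cells closed in the kernel by Cha's index bound (UPPER) + the two-engine unit-coefficient certificate (LOWER: BCS (a) + Greenberg 4.1)

HONEST FRAMING (cell `b2b-bsdres-*`, verbatim): the cell deletes COMBINATION-SHAPED residual classes of
the rank-≤1 BSD formula from PUBLISHED theorems only and TYPES the construction-shaped remainder; this
is not "finishing BSD". Class X9 stays TYPED at class level: its typed input `IntegralMainConjectureOnClassX9`
stays OPEN as a ∀-statement. Everything here is PER PAIR; nothing is booked; no named fact. Unit `b2b-bsdres-x9`,
gen 16 (class-closure N3 lead; E1 line 'typed target INHABITED at the pair' of `class-closure/N3/WEEK-2026-08-28.md`,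
continuing gen 15's `X9/MainConjectureInstancesN3{,b,c,d}.lean` = 19 instances; with this part's 4 the count is 23).

WHAT (as in part 1): gen 5's `mazurMainConjecture_with_mu_zero_of_bsdp` — at a good ordinary irreducible `p ≥ 5` with
`r_an(E) = 0`, BCS 2025 Thm. 1.1.2 (a) gives `char X(E/ℚ_∞) = (g)` with `ι g = p^k·L_p`; `BSD(E,p)` forces `k = 0` and ONE
unit coefficient of `ϖ·L_p(f_E, α)` (`hcert`) gives `μ(g) = 0` — composed (gen 15's integer-model form
`mazurMainConjecture_of_ainvs_of_bsdp`) with the pair's OWN kernel `BSD(E,p)` theorem, applied BY NAME with its binders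
copied verbatim: `bsdp_u38088v1` (`X9/ChaUnitCoeffRecordsS4.lean`), `bsdp_u464648c1` (`X9/ChaUnitCoeffRecordsS4.lean`), `bsdp_u219024bv1` (`X9/ChaUnitCoeffRecordsS4.lean`), `bsdp_u272484k1` (`X9/ChaUnitCoeffRecordsS4b.lean`). Good ordinary reduction and irreducibility are decided in the kernel from the integer model
(`card_m<label>_<ℓ>`, or the record file's own point-count lemma reused by name); `hcert` = gen 9 `HOME/b2b-bsdres-x9/g9/mu/MU-ALL.tsv` (two engines, 790/790 X9 pairs), confirmed for
every N3 cell by a THIRD method (iw-1 GEN 11 `MU-CENSUS-N2N3`, 118/118 agree). Instance binders `[IsElliptic]`,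
`[IsGloballyMinimal]` are dischargeable by Kraus' bounded criterion as in the record files.

References: Greenberg, LNM 1716 (1999) Conj. 1.11, Thm. 4.1; Burungale–Castella–Skinner IMRN 2025 Thm. 1.1.2 (a);
Cha 2005 / Miller 2011 Thm. 5.2; Greenberg–Vatsal 2000 §3; Mazur 1978 Prop. 6.3 (1); Cremona's tables.
-/

set_option autoImplicit false

noncomputable section

open scoped Classical MatrixGroups ModularForm

open CongruenceSubgroup WeierstrassCurve Literature.NumberTheory.EllipticCurves
  Literature.NumberTheory.EllipticCurves.ModularForms Literature.NumberTheory.EllipticCurves.Rank1Residual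
  Literature.NumberTheory.EllipticCurves.Rank1Residual.Typed
  Literature.NumberTheory.EllipticCurves.Rank1Residual.X11RankOneCertificates
  Summit.BirchSwinnertonDyer.BirchSwinnertonDyer.Rank1Residual.IntModel
  Summit.BirchSwinnertonDyer.BirchSwinnertonDyer.Rank1Residual.X11RankOne
  Summit.BirchSwinnertonDyer.Rank1Residual.X11b

namespace Summit.BirchSwinnertonDyer.Rank1Residual.X9

/-! ### Kernel data -/





/-! ### The instances -/

/-- **Mazur's main conjecture with `μ = 0` for `(38088v1, 5)`** (Cremona model `[0, 0, 0, 36501, -16230778]`; good ORDINARY at `5`, `a₅ = 2`,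
`#Ẽ(𝔽₅) = 4`; `ρ̄_{E,5}` irreducible — Frobenius witness `ℓ = 11`: `#Ẽ(𝔽₁₁) = 16`, `a₁₁ = -4`, `X² − a₁₁X + 11` root-free
mod `5` — and, census datum, NOT surjective (N3 residue cell of `class-closure/N3/pairs.tsv`); `r_an = 0`): the N3 typed target
(Greenberg's Conj. 1.11 / `IntegralMainConjectureOnClassX9` at the pair) INHABITED at this pair — from the kernel theorem `bsdp_u38088v1`
(`X9/ChaUnitCoeffRecordsS4.lean`: `BSD(E,5)` by Cha's index bound (UPPER) + the two-engine unit-coefficient certificate (LOWER: BCS (a) + Greenberg 4.1), gen 15 — GRH-free, no descent; its binders are copied verbatim below) and the certificate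
`hcert` (`μ(𝓛₅(E)) = 0`: gen 9 `MU-ALL.tsv`, engines B and C, `λ = 2`; iw-1 GEN 11 `MU-CENSUS-N2N3` third method: `UnitCoeff(k=2,n=4,cden=0):B+C`, unit index 2). Composition: gen 15's
`mazurMainConjecture_of_ainvs_of_bsdp` (BCS 2025 Thm. 1.1.2 (a) exponent forced to `0` by `BSD(E,5)`, unit content from `hcert`).
Per pair; the class-level statement stays OPEN; nothing booked. [cite: GreenbergLNM1716, §1 Conj. 1.11 and Thm. 4.1 (p. 102)]
[cite: BurungaleCastellaSkinner2025, Thm. 1.1.2 (a) (p. 2 of arXiv:2405.00270v2)] [cite: Cremona2006, Table 1 (Cremona label 38088v1)] -/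
theorem mazurMainConjecture_u38088v1
    (hBCS : burungale_castella_skinner_charIdeal_eq_padicLFunction)
    (hGr : greenberg_charValue_rankZero)
    (h5 : realPeriodRat_eq_unit_mul_plusPeriod)
    (hmodP : nonempty_modularParametrizationData)
    (hmodL : hasEntireLFunction_rat)
    (hGZK : rank_eq_analyticRank_of_analyticRank_le_one)
    (hCha : Cha2005.thm52_padicValNat_shaOrder_le)
    (W : WeierstrassCurve ℚ)
    [W.IsElliptic]
    [W.IsGloballyMinimal]
    [Fact (Nat.Prime 5)]
    (hW : W = ⟨0, 0, 0, 36501, -16230778⟩)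
    (hr : W.analyticRank = 0)
    {N : ℕ}
    [NeZero N]
    {K : Type}
    [Field K]
    [NumberField K]
    (hK : IsImaginaryQuadratic K)
    (hH : SatisfiesHeegnerHypothesis N K)
    {P : (W.baseChange K).toAffine.Point}
    (hP : IsHeegnerPoint N W K P)
    (hnt : ¬ IsOfFinAddOrder P)
    (hpD : ¬ (5 : ℤ) ∣ NumberField.discr K)
    (hpN : ¬ 5 ^ 2 ∣ N)
    (hI : padicValNat 5 (AddSubgroup.zmultiples P).index ≤ 1)
    {q : ℚ}
    (hq : shaAn W = (q : ℂ))
    (hv : padicValRat 5 q = 2)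
    (hcert : ∀ [NeZero (W.conductorNorm ℤ)] (f : CuspForm (Gamma0 (W.conductorNorm ℤ)) 2),
        IsNewformOf W f → ∀ (ϖ : ℚ), (ϖ : ℝ) * W.realPeriodRat = plusPeriod f →
      ∃ m : ℕ, ‖PowerSeries.coeff m
        (PowerSeries.C (ϖ : ℚ_[5]) * padicLFunction f (unitRoot W 5 : ℚ_[5]))‖ = 1) :
    ∀ (κ : ZpExtension ℚ 5) (γ : Field.absoluteGaloisGroup ℚ),
        κ.IsCyclotomic → κ.IsTopGenerator γ → IsCyclotomicVariable 5 γ →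
      ∀ [NeZero (W.conductorNorm ℤ)] (f : CuspForm (Gamma0 (W.conductorNorm ℤ)) 2),
        IsNewformOf W f → ∀ (ϖ : ℚ), (ϖ : ℝ) * W.realPeriodRat = plusPeriod f →
      ∀ (D : W.SelmerDualData κ γ), D.IsTorsion ∧
        ∃ g : IwasawaAlgebra 5, D.charIdeal = Ideal.span {g} ∧
          GreenbergVatsal2000.HasUnitContent g ∧
          iwasawaToPowerSeries 5 g =
            PowerSeries.C (ϖ : ℚ_[5]) * padicLFunction f (unitRoot W 5 : ℚ_[5]) := by
  have hbsd : BSDp W 5 := bsdp_u38088v1 hBCS hGr h5 hmodP hmodL hGZK hCha W hW hr hK hH hP hnt hpD hpN hI hq hv hcert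
  have hIW : integralModelInt W = ⟨0, 0, 0, 36501, -16230778⟩ :=
    integralModelInt_eq_of_map_eq _ (by rw [hW]; ext <;> simp [WeierstrassCurve.map])
  haveI : Fact (Nat.Prime 11) := ⟨by norm_num⟩
  exact mazurMainConjecture_of_ainvs_of_bsdp hBCS hGr h5 hmodL hGZK 0 0 0 36501 (-16230778) hIW 5 11 16 4 (by norm_num)
    (by decide +kernel) card_u38088v1_5 (by decide) (by decide) (by decide +kernel) card_c38088v1_11 (by decide)
    hr hbsd hcert

/-- **Mazur's main conjecture with `μ = 0` for `(464648c1, 5)`** (Cremona model `[0, 0, 0, -153972731, -735401758298]`; good ORDINARY at `5`, `a₅ = 3`,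
`#Ẽ(𝔽₅) = 3`; `ρ̄_{E,5}` irreducible — Frobenius witness `ℓ = 3`: `#Ẽ(𝔽₃) = 4`, `a₃ = 0`, `X² − a₃X + 3` root-free
mod `5` — and, census datum, NOT surjective (N3 residue cell of `class-closure/N3/pairs.tsv`); `r_an = 0`): the N3 typed target
(Greenberg's Conj. 1.11 / `IntegralMainConjectureOnClassX9` at the pair) INHABITED at this pair — from the kernel theorem `bsdp_u464648c1`
(`X9/ChaUnitCoeffRecordsS4.lean`: `BSD(E,5)` by Cha's index bound (UPPER) + the two-engine unit-coefficient certificate (LOWER: BCS (a) + Greenberg 4.1), gen 15 — GRH-free, no descent; its binders are copied verbatim below) and the certificate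
`hcert` (`μ(𝓛₅(E)) = 0`: gen 9 `MU-ALL.tsv`, engines B and C, `λ = 2`; iw-1 GEN 11 `MU-CENSUS-N2N3` third method: `UnitCoeff(k=2,n=4,cden=0):B+C`, unit index 2). Composition: gen 15's
`mazurMainConjecture_of_ainvs_of_bsdp` (BCS 2025 Thm. 1.1.2 (a) exponent forced to `0` by `BSD(E,5)`, unit content from `hcert`).
Per pair; the class-level statement stays OPEN; nothing booked. [cite: GreenbergLNM1716, §1 Conj. 1.11 and Thm. 4.1 (p. 102)]
[cite: BurungaleCastellaSkinner2025, Thm. 1.1.2 (a) (p. 2 of arXiv:2405.00270v2)] [cite: Cremona2006, Table 1 (Cremona label 464648c1)] -/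
theorem mazurMainConjecture_u464648c1
    (hBCS : burungale_castella_skinner_charIdeal_eq_padicLFunction)
    (hGr : greenberg_charValue_rankZero)
    (h5 : realPeriodRat_eq_unit_mul_plusPeriod)
    (hmodP : nonempty_modularParametrizationData)
    (hmodL : hasEntireLFunction_rat)
    (hGZK : rank_eq_analyticRank_of_analyticRank_le_one)
    (hCha : Cha2005.thm52_padicValNat_shaOrder_le)
    (W : WeierstrassCurve ℚ)
    [W.IsElliptic]
    [W.IsGloballyMinimal]
    [Fact (Nat.Prime 5)]
    (hW : W = ⟨0, 0, 0, -153972731, -735401758298⟩)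
    (hr : W.analyticRank = 0)
    {N : ℕ}
    [NeZero N]
    {K : Type}
    [Field K]
    [NumberField K]
    (hK : IsImaginaryQuadratic K)
    (hH : SatisfiesHeegnerHypothesis N K)
    {P : (W.baseChange K).toAffine.Point}
    (hP : IsHeegnerPoint N W K P)
    (hnt : ¬ IsOfFinAddOrder P)
    (hpD : ¬ (5 : ℤ) ∣ NumberField.discr K)
    (hpN : ¬ 5 ^ 2 ∣ N)
    (hI : padicValNat 5 (AddSubgroup.zmultiples P).index ≤ 1)
    {q : ℚ}
    (hq : shaAn W = (q : ℂ))
    (hv : padicValRat 5 q = 2)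
    (hcert : ∀ [NeZero (W.conductorNorm ℤ)] (f : CuspForm (Gamma0 (W.conductorNorm ℤ)) 2),
        IsNewformOf W f → ∀ (ϖ : ℚ), (ϖ : ℝ) * W.realPeriodRat = plusPeriod f →
      ∃ m : ℕ, ‖PowerSeries.coeff m
        (PowerSeries.C (ϖ : ℚ_[5]) * padicLFunction f (unitRoot W 5 : ℚ_[5]))‖ = 1) :
    ∀ (κ : ZpExtension ℚ 5) (γ : Field.absoluteGaloisGroup ℚ),
        κ.IsCyclotomic → κ.IsTopGenerator γ → IsCyclotomicVariable 5 γ →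
      ∀ [NeZero (W.conductorNorm ℤ)] (f : CuspForm (Gamma0 (W.conductorNorm ℤ)) 2),
        IsNewformOf W f → ∀ (ϖ : ℚ), (ϖ : ℝ) * W.realPeriodRat = plusPeriod f →
      ∀ (D : W.SelmerDualData κ γ), D.IsTorsion ∧
        ∃ g : IwasawaAlgebra 5, D.charIdeal = Ideal.span {g} ∧
          GreenbergVatsal2000.HasUnitContent g ∧
          iwasawaToPowerSeries 5 g =
            PowerSeries.C (ϖ : ℚ_[5]) * padicLFunction f (unitRoot W 5 : ℚ_[5]) := by
  have hbsd : BSDp W 5 := bsdp_u464648c1 hBCS hGr h5 hmodP hmodL hGZK hCha W hW hr hK hH hP hnt hpD hpN hI hq hv hcert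
  have hIW : integralModelInt W = ⟨0, 0, 0, -153972731, -735401758298⟩ :=
    integralModelInt_eq_of_map_eq _ (by rw [hW]; ext <;> simp [WeierstrassCurve.map])
  haveI : Fact (Nat.Prime 3) := ⟨by norm_num⟩
  exact mazurMainConjecture_of_ainvs_of_bsdp hBCS hGr h5 hmodL hGZK 0 0 0 (-153972731) (-735401758298) hIW 5 3 4 3 (by norm_num)
    (by decide +kernel) card_u464648c1_5 (by decide) (by decide) (by decide +kernel) card_c464648c1_3 (by decide)
    hr hbsd hcert

/-- **Mazur's main conjecture with `μ = 0` for `(219024bv1, 5)`** (Cremona model `[0, 0, 0, -6591, -206518]`; good ORDINARY at `5`, `a₅ = 3`,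
`#Ẽ(𝔽₅) = 3`; `ρ̄_{E,5}` irreducible — Frobenius witness `ℓ = 11`: `#Ẽ(𝔽₁₁) = 6`, `a₁₁ = 6`, `X² − a₁₁X + 11` root-free
mod `5` — and, census datum, NOT surjective (N3 residue cell of `class-closure/N3/pairs.tsv`); `r_an = 0`): the N3 typed target
(Greenberg's Conj. 1.11 / `IntegralMainConjectureOnClassX9` at the pair) INHABITED at this pair — from the kernel theorem `bsdp_u219024bv1`
(`X9/ChaUnitCoeffRecordsS4.lean`: `BSD(E,5)` by Cha's index bound (UPPER) + the two-engine unit-coefficient certificate (LOWER: BCS (a) + Greenberg 4.1), gen 15 — GRH-free, no descent; its binders are copied verbatim below) and the certificate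
`hcert` (`μ(𝓛₅(E)) = 0`: gen 9 `MU-ALL.tsv`, engines B and C, `λ = 2`; iw-1 GEN 11 `MU-CENSUS-N2N3` third method: `UnitCoeff(k=2,n=4,cden=0):B+C`, unit index 2). Composition: gen 15's
`mazurMainConjecture_of_ainvs_of_bsdp` (BCS 2025 Thm. 1.1.2 (a) exponent forced to `0` by `BSD(E,5)`, unit content from `hcert`).
Per pair; the class-level statement stays OPEN; nothing booked. [cite: GreenbergLNM1716, §1 Conj. 1.11 and Thm. 4.1 (p. 102)]
[cite: BurungaleCastellaSkinner2025, Thm. 1.1.2 (a) (p. 2 of arXiv:2405.00270v2)] [cite: Cremona2006, Table 1 (Cremona label 219024bv1)] -/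
theorem mazurMainConjecture_u219024bv1
    (hBCS : burungale_castella_skinner_charIdeal_eq_padicLFunction)
    (hGr : greenberg_charValue_rankZero)
    (h5 : realPeriodRat_eq_unit_mul_plusPeriod)
    (hmodP : nonempty_modularParametrizationData)
    (hmodL : hasEntireLFunction_rat)
    (hGZK : rank_eq_analyticRank_of_analyticRank_le_one)
    (hCha : Cha2005.thm52_padicValNat_shaOrder_le)
    (W : WeierstrassCurve ℚ)
    [W.IsElliptic]
    [W.IsGloballyMinimal]
    [Fact (Nat.Prime 5)]
    (hW : W = ⟨0, 0, 0, -6591, -206518⟩)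
    (hr : W.analyticRank = 0)
    {N : ℕ}
    [NeZero N]
    {K : Type}
    [Field K]
    [NumberField K]
    (hK : IsImaginaryQuadratic K)
    (hH : SatisfiesHeegnerHypothesis N K)
    {P : (W.baseChange K).toAffine.Point}
    (hP : IsHeegnerPoint N W K P)
    (hnt : ¬ IsOfFinAddOrder P)
    (hpD : ¬ (5 : ℤ) ∣ NumberField.discr K)
    (hpN : ¬ 5 ^ 2 ∣ N)
    (hI : padicValNat 5 (AddSubgroup.zmultiples P).index ≤ 1)
    {q : ℚ}
    (hq : shaAn W = (q : ℂ))
    (hv : padicValRat 5 q = 2)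
    (hcert : ∀ [NeZero (W.conductorNorm ℤ)] (f : CuspForm (Gamma0 (W.conductorNorm ℤ)) 2),
        IsNewformOf W f → ∀ (ϖ : ℚ), (ϖ : ℝ) * W.realPeriodRat = plusPeriod f →
      ∃ m : ℕ, ‖PowerSeries.coeff m
        (PowerSeries.C (ϖ : ℚ_[5]) * padicLFunction f (unitRoot W 5 : ℚ_[5]))‖ = 1) :
    ∀ (κ : ZpExtension ℚ 5) (γ : Field.absoluteGaloisGroup ℚ),
        κ.IsCyclotomic → κ.IsTopGenerator γ → IsCyclotomicVariable 5 γ →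
      ∀ [NeZero (W.conductorNorm ℤ)] (f : CuspForm (Gamma0 (W.conductorNorm ℤ)) 2),
        IsNewformOf W f → ∀ (ϖ : ℚ), (ϖ : ℝ) * W.realPeriodRat = plusPeriod f →
      ∀ (D : W.SelmerDualData κ γ), D.IsTorsion ∧
        ∃ g : IwasawaAlgebra 5, D.charIdeal = Ideal.span {g} ∧
          GreenbergVatsal2000.HasUnitContent g ∧
          iwasawaToPowerSeries 5 g =
            PowerSeries.C (ϖ : ℚ_[5]) * padicLFunction f (unitRoot W 5 : ℚ_[5]) := by
  have hbsd : BSDp W 5 := bsdp_u219024bv1 hBCS hGr h5 hmodP hmodL hGZK hCha W hW hr hK hH hP hnt hpD hpN hI hq hv hcert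
  have hIW : integralModelInt W = ⟨0, 0, 0, -6591, -206518⟩ :=
    integralModelInt_eq_of_map_eq _ (by rw [hW]; ext <;> simp [WeierstrassCurve.map])
  haveI : Fact (Nat.Prime 11) := ⟨by norm_num⟩
  exact mazurMainConjecture_of_ainvs_of_bsdp hBCS hGr h5 hmodL hGZK 0 0 0 (-6591) (-206518) hIW 5 11 6 3 (by norm_num)
    (by decide +kernel) card_u219024bv1_5 (by decide) (by decide) (by decide +kernel) card_c219024bv1_11 (by decide)
    hr hbsd hcert

/-- **Mazur's main conjecture with `μ = 0` for `(272484k1, 5)`** (Cremona model `[0, 0, 0, 7569, -439002]`; good ORDINARY at `5`, `a₅ = 3`,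
`#Ẽ(𝔽₅) = 3`; `ρ̄_{E,5}` irreducible — Frobenius witness `ℓ = 11`: `#Ẽ(𝔽₁₁) = 6`, `a₁₁ = 6`, `X² − a₁₁X + 11` root-free
mod `5` — and, census datum, NOT surjective (N3 residue cell of `class-closure/N3/pairs.tsv`); `r_an = 0`): the N3 typed target
(Greenberg's Conj. 1.11 / `IntegralMainConjectureOnClassX9` at the pair) INHABITED at this pair — from the kernel theorem `bsdp_u272484k1`
(`X9/ChaUnitCoeffRecordsS4b.lean`: `BSD(E,5)` by Cha's index bound (UPPER) + the two-engine unit-coefficient certificate (LOWER: BCS (a) + Greenberg 4.1), gen 15 — GRH-free, no descent; its binders are copied verbatim below) and the certificate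
`hcert` (`μ(𝓛₅(E)) = 0`: gen 9 `MU-ALL.tsv`, engines B and C, `λ = 2`; iw-1 GEN 11 `MU-CENSUS-N2N3` third method: `UnitCoeff(k=2,n=4,cden=0):B+C`, unit index 2). Composition: gen 15's
`mazurMainConjecture_of_ainvs_of_bsdp` (BCS 2025 Thm. 1.1.2 (a) exponent forced to `0` by `BSD(E,5)`, unit content from `hcert`).
Per pair; the class-level statement stays OPEN; nothing booked. [cite: GreenbergLNM1716, §1 Conj. 1.11 and Thm. 4.1 (p. 102)]
[cite: BurungaleCastellaSkinner2025, Thm. 1.1.2 (a) (p. 2 of arXiv:2405.00270v2)] [cite: Cremona2006, Table 1 (Cremona label 272484k1)] -/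
theorem mazurMainConjecture_u272484k1
    (hBCS : burungale_castella_skinner_charIdeal_eq_padicLFunction)
    (hGr : greenberg_charValue_rankZero)
    (h5 : realPeriodRat_eq_unit_mul_plusPeriod)
    (hmodP : nonempty_modularParametrizationData)
    (hmodL : hasEntireLFunction_rat)
    (hGZK : rank_eq_analyticRank_of_analyticRank_le_one)
    (hCha : Cha2005.thm52_padicValNat_shaOrder_le)
    (W : WeierstrassCurve ℚ)
    [W.IsElliptic]
    [W.IsGloballyMinimal]
    [Fact (Nat.Prime 5)]
    (hW : W = ⟨0, 0, 0, 7569, -439002⟩)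
    (hr : W.analyticRank = 0)
    {N : ℕ}
    [NeZero N]
    {K : Type}
    [Field K]
    [NumberField K]
    (hK : IsImaginaryQuadratic K)
    (hH : SatisfiesHeegnerHypothesis N K)
    {P : (W.baseChange K).toAffine.Point}
    (hP : IsHeegnerPoint N W K P)
    (hnt : ¬ IsOfFinAddOrder P)
    (hpD : ¬ (5 : ℤ) ∣ NumberField.discr K)
    (hpN : ¬ 5 ^ 2 ∣ N)
    (hI : padicValNat 5 (AddSubgroup.zmultiples P).index ≤ 1)
    {q : ℚ}
    (hq : shaAn W = (q : ℂ))
    (hv : padicValRat 5 q = 2)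
    (hcert : ∀ [NeZero (W.conductorNorm ℤ)] (f : CuspForm (Gamma0 (W.conductorNorm ℤ)) 2),
        IsNewformOf W f → ∀ (ϖ : ℚ), (ϖ : ℝ) * W.realPeriodRat = plusPeriod f →
      ∃ m : ℕ, ‖PowerSeries.coeff m
        (PowerSeries.C (ϖ : ℚ_[5]) * padicLFunction f (unitRoot W 5 : ℚ_[5]))‖ = 1) :
    ∀ (κ : ZpExtension ℚ 5) (γ : Field.absoluteGaloisGroup ℚ),
        κ.IsCyclotomic → κ.IsTopGenerator γ → IsCyclotomicVariable 5 γ →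
      ∀ [NeZero (W.conductorNorm ℤ)] (f : CuspForm (Gamma0 (W.conductorNorm ℤ)) 2),
        IsNewformOf W f → ∀ (ϖ : ℚ), (ϖ : ℝ) * W.realPeriodRat = plusPeriod f →
      ∀ (D : W.SelmerDualData κ γ), D.IsTorsion ∧
        ∃ g : IwasawaAlgebra 5, D.charIdeal = Ideal.span {g} ∧
          GreenbergVatsal2000.HasUnitContent g ∧
          iwasawaToPowerSeries 5 g =
            PowerSeries.C (ϖ : ℚ_[5]) * padicLFunction f (unitRoot W 5 : ℚ_[5]) := by
  have hbsd : BSDp W 5 := bsdp_u272484k1 hBCS hGr h5 hmodP hmodL hGZK hCha W hW hr hK hH hP hnt hpD hpN hI hq hv hcert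
  have hIW : integralModelInt W = ⟨0, 0, 0, 7569, -439002⟩ :=
    integralModelInt_eq_of_map_eq _ (by rw [hW]; ext <;> simp [WeierstrassCurve.map])
  haveI : Fact (Nat.Prime 11) := ⟨by norm_num⟩
  exact mazurMainConjecture_of_ainvs_of_bsdp hBCS hGr h5 hmodL hGZK 0 0 0 7569 (-439002) hIW 5 11 6 3 (by norm_num)
    (by decide +kernel) card_u272484k1_5 (by decide) (by decide) (by decide +kernel) card_c272484k1_11 (by decide)
    hr hbsd hcert

end Summit.BirchSwinnertonDyer.Rank1Residual.X9

end
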